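import Mathlib
import Literature.Analysis.ODE.InverseSquareTailParticular

/-!
# The chain of coefficient functions of the `t`-polynomial solutions of
# `ψ_tt − ψ_xx + (ℓ(ℓ+1)/x² + W)ψ = 0` at the far end

Analysis/ODE support file (everything proved, no definitions), continuing
`InverseSquareTailParticular.lean`. A `t`-polynomial `p(t,x) = Σ_{m ≤ N/2} c_m(x) t^{N−2m}`
solves the 1+1 wave equation `p_tt − p_xx + V p = 0`, `V = ℓ(ℓ+1)/x² + W`, iff

  `c_0'' = V c_0`,   `c_m'' = V c_m + (N−2m+2)(N−2m+1) c_{m−1}`  (`m ≥ 1`).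

Starting from the recessive solution `c_0 = u ~ x^{-ℓ}` and descending with the particular solutions
of `InverseSquareTailParticular.lean` gives, for every `N ≤ ℓ`, a chain with

  `c_m = κ_m x^{2m−ℓ} + O(x^{2m−ℓ−1/2})`,  `c_m' = κ_m (2m−ℓ) x^{2m−ℓ−1} + O(x^{2m−ℓ−3/2})`,
  `κ_0 = 1`,  `κ_m · 2m(2ℓ−2m+1) = −(N−2m+2)(N−2m+1) κ_{m−1}`

(`exists_polyChain_inverseSquareTail`): these are the finite-energy `t`-polynomial solutions whose
Cauchy data at `t = 0` — `(c_{N/2}, 0) ~ (κ x^{N−ℓ}, 0)` for even `N`, `(0, c_{(N−1)/2}) ~ (0, κ x^{N−1−ℓ})`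
for odd `N` — are the Regge–Wheeler form of the Kenig–Lawrie–Liu–Schlag kernel data `r^{2k−d}`
(`d = 2ℓ+3`) up to relative `O(x^{-1/2})`. Route PhotonSphereChannels, `FixedModeChannels`, far side
(stmt-FinalStateConjecture-10048). Folklore given the previous files.
-/

noncomputable section

namespace Literature.Analysis.ODE

open MeasureTheory Set Filter Topology Real

variable {W : ℝ → ℝ} {X A : ℝ}

/-- **The coefficient chain.** See the module docstring. Hypotheses: `X ≥ 1`, `W` continuous on
`[X, ∞)` with `|W| ≤ A/(x²√x)`, `12A ≤ √X`, `N ≤ ℓ`. Conclusion: families `c, c' : ℕ → ℝ → ℝ`,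
constants `κ : ℕ → ℝ` and one error constant `K` such that for all `m` with `2m ≤ N`: `c m, c' m`
are continuous on `[X, ∞)`, `c' m = (c m)'` on `(X, ∞)`, the coupled equations hold on `(X, ∞)`,
the asymptotics hold on `[X, ∞)`, `κ 0 = 1` with the recursion, and `c 0 > 0`. [folklore] -/
theorem exists_polyChain_inverseSquareTail (ℓ N : ℕ) (hN : N ≤ ℓ) (hX : 1 ≤ X)
    (hW : ContinuousOn W (Ici X)) (hWA : ∀ y, X ≤ y → |W y| ≤ A / (y ^ 2 * Real.sqrt y))
    (hAX : 12 * A ≤ Real.sqrt X) :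
    ∃ (c c' : ℕ → ℝ → ℝ) (κ : ℕ → ℝ) (K : ℝ),
      κ 0 = 1
      ∧ (∀ m, 1 ≤ m → 2 * m ≤ N →
          κ m * (2 * m * (2 * ℓ - 2 * m + 1)) = -(((N : ℝ) - 2 * m + 2) * ((N : ℝ) - 2 * m + 1)) * κ (m - 1))
      ∧ (∀ m, 2 * m ≤ N →
          ContinuousOn (c m) (Ici X) ∧ ContinuousOn (c' m) (Ici X)
          ∧ (∀ x, X < x → HasDerivAt (c m) (c' m x) x)
          ∧ (∀ x, X ≤ x → |c m x - κ m * x ^ (2 * (m : ℝ) - ℓ)| ≤ K * x ^ (2 * (m : ℝ) - ℓ - 1 / 2))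
          ∧ (∀ x, X ≤ x → |c' m x - κ m * (2 * (m : ℝ) - ℓ) * x ^ (2 * (m : ℝ) - ℓ - 1)|
              ≤ K * x ^ (2 * (m : ℝ) - ℓ - 1 - 1 / 2)))
      ∧ (∀ x, X < x → HasDerivAt (c' 0) (((ℓ : ℝ) * (ℓ + 1) / x ^ 2 + W x) * c 0 x) x)
      ∧ (∀ m, 1 ≤ m → 2 * m ≤ N → ∀ x, X < x →
          HasDerivAt (c' m) (((ℓ : ℝ) * (ℓ + 1) / x ^ 2 + W x) * c m x
            + ((N : ℝ) - 2 * m + 2) * ((N : ℝ) - 2 * m + 1) * c (m - 1) x) x)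
      ∧ (∀ x, X ≤ x → 0 < c 0 x) := by
  have hX0 : 0 < X := lt_of_lt_of_le one_pos hX
  obtain ⟨u, u', u₂, u₂', K₀, huc, hu'c, hu₂c, hu₂'c, hud, hu'd, hu₂d, hu₂'d, hwr, hupos, hu_as, hu'_as,
    hu₂_as, hu₂'_as⟩ := exists_fundamental_inverseSquareTail ℓ hX hW hWA hAX
  -- induction on the length of the chain
  suffices H : ∀ M : ℕ, 2 * M ≤ N → ∃ (c c' : ℕ → ℝ → ℝ) (κ : ℕ → ℝ) (K : ℝ),
      c 0 = u ∧ c' 0 = u' ∧ κ 0 = 1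
      ∧ (∀ m, 1 ≤ m → m ≤ M →
          κ m * (2 * m * (2 * ℓ - 2 * m + 1)) = -(((N : ℝ) - 2 * m + 2) * ((N : ℝ) - 2 * m + 1)) * κ (m - 1))
      ∧ (∀ m, m ≤ M →
          ContinuousOn (c m) (Ici X) ∧ ContinuousOn (c' m) (Ici X)
          ∧ (∀ x, X < x → HasDerivAt (c m) (c' m x) x)
          ∧ (∀ x, X ≤ x → |c m x - κ m * x ^ (2 * (m : ℝ) - ℓ)| ≤ K * x ^ (2 * (m : ℝ) - ℓ - 1 / 2))
          ∧ (∀ x, X ≤ x → |c' m x - κ m * (2 * (m : ℝ) - ℓ) * x ^ (2 * (m : ℝ) - ℓ - 1)|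
              ≤ K * x ^ (2 * (m : ℝ) - ℓ - 1 - 1 / 2)))
      ∧ (∀ m, 1 ≤ m → m ≤ M → ∀ x, X < x →
          HasDerivAt (c' m) (((ℓ : ℝ) * (ℓ + 1) / x ^ 2 + W x) * c m x
            + ((N : ℝ) - 2 * m + 2) * ((N : ℝ) - 2 * m + 1) * c (m - 1) x) x) by
    obtain ⟨c, c', κ, K, hc0, hc'0, hκ0, hκ, hlev, hode⟩ := H (N / 2) (Nat.mul_div_le N 2)
    refine ⟨c, c', κ, K, hκ0, fun m hm hmN => hκ m hm (by omega), fun m hmN => hlev m (by omega),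
      fun x hx => ?_, fun m hm hmN x hx => hode m hm (by omega) x hx, fun x hx => ?_⟩
    · rw [hc0, hc'0]; exact hu'd x hx
    · rw [hc0]; exact hupos x hx
  intro M
  induction M with
  | zero =>
    intro _
    refine ⟨fun _ => u, fun _ => u', fun _ => 1, K₀, rfl, rfl, rfl, fun m hm hm0 => by omega,
      fun m hm => ?_, fun m hm hm0 => by omega⟩
    obtain rfl : m = 0 := by omega
    refine ⟨huc, hu'c, hud, fun x hx => ?_, fun x hx => ?_⟩
    · have h := hu_as x hx
      simp only [Nat.cast_zero, mul_zero, zero_sub, one_mul]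
      exact h
    · have h := hu'_as x hx
      simp only [Nat.cast_zero, mul_zero, zero_sub, one_mul]
      exact h
  | succ M ih =>
    intro hM
    obtain ⟨c, c', κ, K, hc0, hc'0, hκ0, hκ, hlev, hode⟩ := ih (by omega)
    -- the forcing at the new level: `g = (N−2M)(N−2M−1) c M`
    obtain ⟨hcMc, hcM'c, hcMd, hcM_as, hcM'_as⟩ := hlev M le_rfl
    set γ₀ : ℝ := ((N : ℝ) - 2 * (M + 1 : ℕ) + 2) * ((N : ℝ) - 2 * (M + 1 : ℕ) + 1) with hγ₀
    set g : ℝ → ℝ := fun x => γ₀ * c M x with hg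
    have hgc : ContinuousOn g (Ici X) := continuousOn_const.mul hcMc
    have hq1 : (2 * (M : ℝ) - ℓ) < ℓ - 1 := by
      have : (2 * (M + 1 : ℕ) : ℝ) ≤ N := by exact_mod_cast hM
      have : (N : ℝ) ≤ ℓ := by exact_mod_cast hN
      push_cast at *
      linarith
    have hq2 : -(ℓ : ℝ) - 1 ≤ 2 * (M : ℝ) - ℓ := by
      have : (0 : ℝ) ≤ M := Nat.cast_nonneg M
      linarith
    have hg_as : ∀ x, X ≤ x → |g x - γ₀ * κ M * x ^ (2 * (M : ℝ) - ℓ)|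
        ≤ |γ₀| * K * x ^ (2 * (M : ℝ) - ℓ - 1 / 2) := by
      intro x hx
      have h := hcM_as x hx
      simp only [hg]
      rw [show γ₀ * c M x - γ₀ * κ M * x ^ (2 * (M : ℝ) - ℓ)
          = γ₀ * (c M x - κ M * x ^ (2 * (M : ℝ) - ℓ)) by ring, abs_mul, mul_assoc]
      exact mul_le_mul_of_nonneg_left h (abs_nonneg _)
    obtain ⟨a, a', K', hac, ha'c, had, ha'd, ha_as, ha'_as⟩ :=
      exists_particular_inverseSquareTail ℓ hX huc hu'c hu₂c hu₂'c hud hu'd hu₂d hu₂'d hwr hu_as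
        hu'_as hu₂_as hu₂'_as hgc hq1 hq2 hg_as
    -- the new leading constant
    set κ₁ : ℝ := -(γ₀ * κ M) / (((ℓ : ℝ) - (2 * (M : ℝ) - ℓ) - 1) * ((2 * (M : ℝ) - ℓ) + ℓ + 2)) with hκ₁
    have hK0 : 0 ≤ K := by
      have h := hcM_as X le_rfl
      exact nonneg_of_abs_le_mul_rpow hX0 h
    have hK'0 : 0 ≤ K' := nonneg_of_abs_le_mul_rpow hX0 (ha_as X le_rfl)
    refine ⟨Function.update c (M + 1) a, Function.update c' (M + 1) a', Function.update κ (M + 1) κ₁,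
      K + K', ?_, ?_, ?_, fun m hm hmM => ?_, fun m hmM => ?_, fun m hm hmM x hx => ?_⟩
    · rw [Function.update_of_ne (by omega)]; exact hc0
    · rw [Function.update_of_ne (by omega)]; exact hc'0
    · rw [Function.update_of_ne (by omega)]; exact hκ0
    · -- recursion for `κ`
      rcases Nat.lt_or_ge m (M + 1) with hlt | hge
      · rw [Function.update_of_ne (by omega), Function.update_of_ne (by omega)]
        exact hκ m hm (by omega)
      · obtain rfl : m = M + 1 := by omega
        rw [Function.update_self, Function.update_of_ne (by omega), Nat.add_sub_cancel, hκ₁, hγ₀]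
        have h1 : ((ℓ : ℝ) - (2 * (M : ℝ) - ℓ) - 1) ≠ 0 := by
          have : (2 * (M + 1 : ℕ) : ℝ) ≤ N := by exact_mod_cast hM
          have : (N : ℝ) ≤ ℓ := by exact_mod_cast hN
          push_cast at *
          intro h; linarith
        have h2 : ((2 * (M : ℝ) - ℓ) + ℓ + 2) ≠ 0 := by
          have : (0 : ℝ) ≤ M := Nat.cast_nonneg M
          intro h; linarith
        push_cast
        field_simp
        ring
    · -- level properties
      rcases Nat.lt_or_ge m (M + 1) with hlt | hge
      · simp only [Function.update_of_ne (show m ≠ M + 1 by omega)]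
        obtain ⟨h1, h2, h3, h4, h5⟩ := hlev m (by omega)
        refine ⟨h1, h2, h3, fun x hx => ?_, fun x hx => ?_⟩
        · exact (h4 x hx).trans (mul_le_mul_of_nonneg_right (by linarith)
            (Real.rpow_pos_of_pos (hX0.trans_le hx) _).le)
        · exact (h5 x hx).trans (mul_le_mul_of_nonneg_right (by linarith)
            (Real.rpow_pos_of_pos (hX0.trans_le hx) _).le)
      · obtain rfl : m = M + 1 := by omega
        simp only [Function.update_self]
        refine ⟨hac, ha'c, had, fun x hx => ?_, fun x hx => ?_⟩
        · have h := ha_as x hx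
          have e : (2 * (M : ℝ) - ℓ) + 2 = 2 * ((M + 1 : ℕ) : ℝ) - ℓ := by push_cast; ring
          rw [e] at h
          exact h.trans (mul_le_mul_of_nonneg_right (by linarith)
            (Real.rpow_pos_of_pos (hX0.trans_le hx) _).le)
        · have h := ha'_as x hx
          have e1 : (2 * (M : ℝ) - ℓ) + 2 = 2 * ((M + 1 : ℕ) : ℝ) - ℓ := by push_cast; ring
          have e2 : (2 * (M : ℝ) - ℓ) + 1 = 2 * ((M + 1 : ℕ) : ℝ) - ℓ - 1 := by push_cast; ring
          rw [e1, e2] at h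
          exact h.trans (mul_le_mul_of_nonneg_right (by linarith)
            (Real.rpow_pos_of_pos (hX0.trans_le hx) _).le)
    · -- the coupled equation
      rcases Nat.lt_or_ge m (M + 1) with hlt | hge
      · rw [Function.update_of_ne (by omega), Function.update_of_ne (by omega),
          Function.update_of_ne (by omega)]
        exact hode m hm (by omega) x hx
      · obtain rfl : m = M + 1 := by omega
        rw [Function.update_self, Function.update_self, Function.update_of_ne (by omega),
          Nat.add_sub_cancel]
        have h := ha'd x hx
        simp only [hg, hγ₀] at h
        convert h using 1

/-! ### Regularity packaging and size bounds -/

/-- From a `C¹` pair `(c, c')` with `dc/dx = c'`, `dc'/dx = F` (`F` continuous) on an open set: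
`c` is `C²` there, `deriv c = c'` and `iteratedDeriv 2 c = F`. [folklore] -/
theorem contDiffOn_two_of_hasDerivAt_pair {c c' F : ℝ → ℝ} {S : Set ℝ} (hS : IsOpen S)
    (hc : ∀ x ∈ S, HasDerivAt c (c' x) x) (hc' : ∀ x ∈ S, HasDerivAt c' (F x) x)
    (hF : ContinuousOn F S) :
    ContDiffOn ℝ 2 c S ∧ (∀ x ∈ S, deriv c x = c' x) ∧ (∀ x ∈ S, iteratedDeriv 2 c x = F x) := by
  have hd1 : ∀ x ∈ S, deriv c x = c' x := fun x hx => (hc x hx).deriv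
  have hd2 : ∀ x ∈ S, deriv c' x = F x := fun x hx => (hc' x hx).deriv
  have hdd : ∀ x ∈ S, deriv (deriv c) x = F x := by
    intro x hx
    have hev : deriv c =ᶠ[𝓝 x] c' :=
      Filter.eventuallyEq_of_mem (hS.mem_nhds hx) fun y hy => hd1 y hy
    rw [hev.deriv_eq, hd2 x hx]
  refine ⟨?_, hd1, fun x hx => ?_⟩
  · rw [show (2 : WithTop ℕ∞) = 1 + 1 from rfl, contDiffOn_succ_iff_deriv_of_isOpen hS]
    refine ⟨fun x hx => (hc x hx).differentiableAt.differentiableWithinAt, fun h => ?_, ?_⟩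
    · exact absurd h (by decide)
    · rw [show (1 : WithTop ℕ∞) = 0 + 1 from rfl, contDiffOn_succ_iff_deriv_of_isOpen hS]
      refine ⟨fun x hx => ?_, fun h => absurd h (by decide), ?_⟩
      · have : DifferentiableAt ℝ c' x := (hc' x hx).differentiableAt
        exact (this.congr_of_eventuallyEq (Filter.eventuallyEq_of_mem (hS.mem_nhds hx)
          fun y hy => hd1 y hy)).differentiableWithinAt
      · exact (contDiffOn_zero.2 hF).congr fun x hx => hdd x hx
  · rw [iteratedDeriv_succ, iteratedDeriv_one]
    exact hdd x hx

/-- **Regularity and size of the chain.** Under the hypotheses of `exists_polyChain_inverseSquareTail`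
(same data), with `V = ℓ(ℓ+1)/x² + W`: every `c m` (`2m ≤ N`) is `C²` on `(X, ∞)` with
`deriv (c m) = c' m`, `iteratedDeriv 2 (c 0) = V c 0`,
`iteratedDeriv 2 (c m) = V c m + (N−2m+2)(N−2m+1) c (m−1)` (`m ≥ 1`); all `κ m ≠ 0`; and there is
one constant `K₂` with `|c m x| ≤ K₂ x^{2m−ℓ}`, `|c' m x| ≤ K₂ x^{2m−ℓ−1}` on `[X, ∞)`. [folklore] -/
theorem exists_polyChain_inverseSquareTail' (ℓ N : ℕ) (hN : N ≤ ℓ) (hX : 1 ≤ X)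
    (hW : ContinuousOn W (Ici X)) (hWA : ∀ y, X ≤ y → |W y| ≤ A / (y ^ 2 * Real.sqrt y))
    (hAX : 12 * A ≤ Real.sqrt X) :
    ∃ (c c' : ℕ → ℝ → ℝ) (κ : ℕ → ℝ) (K K₂ : ℝ),
      κ 0 = 1
      ∧ (∀ m, 1 ≤ m → 2 * m ≤ N →
          κ m * (2 * m * (2 * ℓ - 2 * m + 1)) = -(((N : ℝ) - 2 * m + 2) * ((N : ℝ) - 2 * m + 1)) * κ (m - 1))
      ∧ (∀ m, 2 * m ≤ N → κ m ≠ 0)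
      ∧ (∀ m, 2 * m ≤ N →
          ContinuousOn (c m) (Ici X) ∧ ContinuousOn (c' m) (Ici X)
          ∧ ContDiffOn ℝ 2 (c m) (Ioi X)
          ∧ (∀ x, X < x → HasDerivAt (c m) (c' m x) x)
          ∧ (∀ x, X < x → deriv (c m) x = c' m x)
          ∧ (∀ x, X ≤ x → |c m x - κ m * x ^ (2 * (m : ℝ) - ℓ)| ≤ K * x ^ (2 * (m : ℝ) - ℓ - 1 / 2))
          ∧ (∀ x, X ≤ x → |c' m x - κ m * (2 * (m : ℝ) - ℓ) * x ^ (2 * (m : ℝ) - ℓ - 1)|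
              ≤ K * x ^ (2 * (m : ℝ) - ℓ - 1 - 1 / 2))
          ∧ (∀ x, X ≤ x → |c m x| ≤ K₂ * x ^ (2 * (m : ℝ) - ℓ))
          ∧ (∀ x, X ≤ x → |c' m x| ≤ K₂ * x ^ (2 * (m : ℝ) - ℓ - 1)))
      ∧ (∀ x, X < x → iteratedDeriv 2 (c 0) x = ((ℓ : ℝ) * (ℓ + 1) / x ^ 2 + W x) * c 0 x)
      ∧ (∀ m, 1 ≤ m → 2 * m ≤ N → ∀ x, X < x →
          iteratedDeriv 2 (c m) x = ((ℓ : ℝ) * (ℓ + 1) / x ^ 2 + W x) * c m x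
            + ((N : ℝ) - 2 * m + 2) * ((N : ℝ) - 2 * m + 1) * c (m - 1) x)
      ∧ (∀ x, X ≤ x → 0 < c 0 x) := by
  have hX0 : 0 < X := lt_of_lt_of_le one_pos hX
  obtain ⟨c, c', κ, K, hκ0, hκ, hlev, hode0, hode, hpos⟩ :=
    exists_polyChain_inverseSquareTail ℓ N hN hX hW hWA hAX
  -- the potential is continuous on `(X, ∞)`
  have hVc : ContinuousOn (fun x : ℝ => (ℓ : ℝ) * (ℓ + 1) / x ^ 2 + W x) (Ioi X) := by
    refine ContinuousOn.add ?_ (hW.mono Ioi_subset_Ici_self)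
    exact continuousOn_const.div (continuousOn_id.pow 2) fun x hx => pow_ne_zero _ (hX0.trans hx).ne'
  -- `κ m ≠ 0`
  have hκne : ∀ m, 2 * m ≤ N → κ m ≠ 0 := by
    intro m
    induction m with
    | zero => intro _; rw [hκ0]; exact one_ne_zero
    | succ m ih =>
      intro hm
      have h := hκ (m + 1) (by omega) hm
      rw [Nat.add_sub_cancel] at h
      have ih' := ih (by omega)
      have hf1 : (2 * ((m + 1 : ℕ) : ℝ) * (2 * ℓ - 2 * ((m + 1 : ℕ) : ℝ) + 1)) ≠ 0 := by
        have : (2 * (m + 1 : ℕ) : ℝ) ≤ N := by exact_mod_cast hm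
        have : (N : ℝ) ≤ ℓ := by exact_mod_cast hN
        push_cast at *
        have h1 : (0 : ℝ) < 2 * ((m : ℝ) + 1) := by positivity
        have h2 : (0 : ℝ) < 2 * (ℓ : ℝ) - 2 * ((m : ℝ) + 1) + 1 := by linarith
        positivity
      have hf2 : -(((N : ℝ) - 2 * ((m + 1 : ℕ) : ℝ) + 2) * ((N : ℝ) - 2 * ((m + 1 : ℕ) : ℝ) + 1)) ≠ 0 := by
        have : (2 * (m + 1 : ℕ) : ℝ) ≤ N := by exact_mod_cast hm
        push_cast at *
        have h1 : (0 : ℝ) < (N : ℝ) - 2 * ((m : ℝ) + 1) + 2 := by linarith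
        have h2 : (0 : ℝ) < (N : ℝ) - 2 * ((m : ℝ) + 1) + 1 := by linarith
        have := mul_pos h1 h2
        intro h0; rw [neg_eq_zero] at h0; linarith
      intro h0
      rw [h0, zero_mul] at h
      exact absurd h.symm (mul_ne_zero hf2 ih')
  -- the size constant
  set K₂ : ℝ := ∑ m ∈ Finset.range (N / 2 + 1), (|κ m| * (1 + |2 * (m : ℝ) - ℓ|) + K) with hK₂
  have hK0 : 0 ≤ K := by
    obtain ⟨_, _, _, h4, _⟩ := hlev 0 (by omega)
    exact nonneg_of_abs_le_mul_rpow hX0 (h4 X le_rfl)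
  have hK₂m : ∀ m, 2 * m ≤ N → |κ m| * (1 + |2 * (m : ℝ) - ℓ|) + K ≤ K₂ := by
    intro m hm
    have hmem : m ∈ Finset.range (N / 2 + 1) := Finset.mem_range.2 (by omega)
    exact Finset.single_le_sum (f := fun m => |κ m| * (1 + |2 * (m : ℝ) - ℓ|) + K)
      (fun i _ => by positivity) hmem
  refine ⟨c, c', κ, K, K₂, hκ0, hκ, hκne, fun m hm => ?_, fun x hx => ?_, fun m hm1 hm x hx => ?_, hpos⟩
  · obtain ⟨h1, h2, h3, h4, h5⟩ := hlev m hm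
    -- second derivative as a continuous function on `(X, ∞)`
    have hreg : ContDiffOn ℝ 2 (c m) (Ioi X) ∧ (∀ x ∈ Ioi X, deriv (c m) x = c' m x) := by
      rcases Nat.eq_zero_or_pos m with h0 | hpos'
      · subst h0
        have h := contDiffOn_two_of_hasDerivAt_pair isOpen_Ioi (fun x hx => h3 x hx)
          (fun x hx => hode0 x hx) (hVc.mul (h1.mono Ioi_subset_Ici_self))
        exact ⟨h.1, h.2.1⟩
      · obtain ⟨g1, -, -, -, -⟩ := hlev (m - 1) (by omega)
        have hF : ContinuousOn (fun x => ((ℓ : ℝ) * (ℓ + 1) / x ^ 2 + W x) * c m x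
            + ((N : ℝ) - 2 * m + 2) * ((N : ℝ) - 2 * m + 1) * c (m - 1) x) (Ioi X) :=
          (hVc.mul (h1.mono Ioi_subset_Ici_self)).add
            (continuousOn_const.mul (g1.mono Ioi_subset_Ici_self))
        have h := contDiffOn_two_of_hasDerivAt_pair isOpen_Ioi (fun x hx => h3 x hx)
          (fun x hx => hode m hpos' hm x hx) hF
        exact ⟨h.1, h.2.1⟩
    refine ⟨h1, h2, hreg.1, h3, fun x hx => hreg.2 x hx, h4, h5, fun x hx => ?_, fun x hx => ?_⟩
    · have hx1 : 1 ≤ x := hX.trans hx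
      have hb := abs_le_of_asymp hx1 (h4 x hx)
      refine hb.trans (mul_le_mul_of_nonneg_right ?_ (Real.rpow_pos_of_pos (hX0.trans_le hx) _).le)
      refine le_trans ?_ (hK₂m m hm)
      have : 0 ≤ |κ m| * |2 * (m : ℝ) - ℓ| := by positivity
      nlinarith [abs_nonneg (κ m)]
    · have hx1 : 1 ≤ x := hX.trans hx
      have hb := abs_le_of_asymp hx1 (h5 x hx)
      refine hb.trans (mul_le_mul_of_nonneg_right ?_ (Real.rpow_pos_of_pos (hX0.trans_le hx) _).le)
      refine le_trans ?_ (hK₂m m hm)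
      rw [abs_mul]
      nlinarith [abs_nonneg (κ m), abs_nonneg (2 * (m : ℝ) - ℓ)]
  · obtain ⟨h1, -, h3, -, -⟩ := hlev 0 (by omega)
    have h := contDiffOn_two_of_hasDerivAt_pair isOpen_Ioi (fun x hx => h3 x hx)
      (fun x hx => hode0 x hx) (hVc.mul (h1.mono Ioi_subset_Ici_self))
    exact h.2.2 x hx
  · obtain ⟨h1, -, h3, -, -⟩ := hlev m hm
    obtain ⟨g1, -, -, -, -⟩ := hlev (m - 1) (by omega)
    have hF : ContinuousOn (fun x => ((ℓ : ℝ) * (ℓ + 1) / x ^ 2 + W x) * c m x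
        + ((N : ℝ) - 2 * m + 2) * ((N : ℝ) - 2 * m + 1) * c (m - 1) x) (Ioi X) :=
      (hVc.mul (h1.mono Ioi_subset_Ici_self)).add (continuousOn_const.mul (g1.mono Ioi_subset_Ici_self))
    have h := contDiffOn_two_of_hasDerivAt_pair isOpen_Ioi (fun x hx => h3 x hx)
      (fun x hx => hode m hm1 hm x hx) hF
    exact h.2.2 x hx

end Literature.Analysis.ODE
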